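import Summits.NavierStokesRegularity.NavierStokesRegularity.Theorems.AxisymmetricExtremalityAxisymmetricKatoGlobalStubSeregin2020TypeIILemma22EnergyClassAcrossAxis
import HarnessLib

/-!
# Seregin 2020, Lemma 2.2: the energy-class inequality across the regular axis in the CANONICAL (v3, SPLIT) `EnergyClass` text
# — L22-B, piece F2′ (cut owner ns-inputs-plan g5, A1 item 13: «F3's conclusion MUST be the v3 split text»)

Seat ns-es-p1 g3.  `energyClass_ineq_acrossAxis` (sibling `…Lemma22EnergyClassAcrossAxis`, single space–time integral of the four-term sum)
rewritten with the right-hand side as FOUR split space–time integrals, `4 * ∫ η H(Φ)|∇Θ|²` + `∫ η H(Φ)⟪U,∇Θ²⟫` + `∫ η (2/ϱ)H(Φ)∂_ϱΘ²`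
+ `∫ |η′| H(Φ)Θ²` — VERBATIM the body of `EnergyClass` in the registered skeleton v3
(`Cruxes/AxisymmetricKatoGlobal/Seregin2020Lemma22ExpansionOfPositivity.lean` l.68–84; kits/A1-sig-EnergyClass-v3.md), for a given admissible
`(H, Θ, η, t₁ ≤ t)` on an `S`-free slab across the regular axis.  The four summands are integrable
(`integrable_sliceIntegrands_acrossAxis`, bounded `η`, `η′`), so `∫Σ = Σ∫`.

WHAT THIS IS NOT: not the `S`-passage (`energyClass_acrossAxis_of_classV`), not Lemma 2.2, not NS regularity.  No summit statement is proved.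
[NazarovUraltseva2012 §3 (3.3), (3.9); Seregin2020 §3]
-/

-- the problem directory repeats the summit name (D-0017); core's `dupNamespace` linter fires
set_option linter.dupNamespace false

noncomputable section

open MeasureTheory Set Function Filter Topology TopologicalSpace Metric WithLp intervalIntegral
open scoped NNReal ENNReal InnerProductSpace RealInnerProductSpace

namespace Summit.NavierStokesRegularity.NavierStokesRegularity.Theorems.AxisymmetricKatoGlobal.EulerScaling

open Literature.Analysis.FluidPDE Literature.Analysis.FluidPDE.Seregin2020

/-- **The energy-class inequality across the regular axis, v3 SPLIT text** (module docstring).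
[cite: NazarovUraltseva2012, §3 (3.3), (3.9), Remark 9] -/
theorem energyClass_ineq_acrossAxis_v3 {O : Set (EuclideanSpace ℝ (Fin 3))} (hO : IsOpen O) {lo hi : ℝ}
    {Φ : ℝ → EuclideanSpace ℝ (Fin 3) → ℝ} {U : ℝ → EuclideanSpace ℝ (Fin 3) → EuclideanSpace ℝ (Fin 3)}
    (hΦc : ContinuousOn (uncurry Φ) (Ioo lo hi ×ˢ O))
    (hΦg : ContinuousOn (fun z : ℝ × EuclideanSpace ℝ (Fin 3) => fderiv ℝ (Φ z.1) z.2) (Ioo lo hi ×ˢ O))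
    (hΦs : ∀ z ∈ Ioo lo hi ×ˢ (O ∩ {x | cylRadius x ≠ 0}), ContDiffAt ℝ 2 (Φ z.1) z.2)
    (hΦt : ∀ z ∈ Ioo lo hi ×ˢ (O ∩ {x | cylRadius x ≠ 0}), DifferentiableAt ℝ (fun r => Φ r z.2) z.1)
    (hΦt' : ContinuousOn (fun z : ℝ × EuclideanSpace ℝ (Fin 3) => deriv (fun r => Φ r z.2) z.1)
      (Ioo lo hi ×ˢ (O ∩ {x | cylRadius x ≠ 0})))
    (hUc : ContinuousOn (uncurry U) (Ioo lo hi ×ˢ (O ∩ {x | cylRadius x ≠ 0})))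
    (hUs : ∀ z ∈ Ioo lo hi ×ˢ (O ∩ {x | cylRadius x ≠ 0}), ContDiffAt ℝ 1 (U z.1) z.2)
    (hdivU : ∀ z ∈ Ioo lo hi ×ˢ (O ∩ {x | cylRadius x ≠ 0}), VectorCalculus.divergence (U z.1) z.2 = 0)
    (hU3 : (∫⁻ z in Ioo lo hi ×ˢ O, ‖U z.1 z.2‖ₑ ^ (3 : ℕ)) < ⊤)
    (hsup : ∀ z ∈ Ioo lo hi ×ˢ (O ∩ {x | cylRadius x ≠ 0}), 0 ≤ deriv (fun r => Φ r z.2) z.1 +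
      fderiv ℝ (Φ z.1) z.2 (U z.1 z.2) + 2 / cylRadius z.2 * partialDeriv (eR z.2) (Φ z.1) z.2 -
      (Laplacian.laplacian (Φ z.1)) z.2)
    {k : ℝ} (hk : ∀ z ∈ Ioo lo hi ×ˢ O, cylRadius z.2 = 0 → k ≤ Φ z.1 z.2)
    {H : ℝ → ℝ} (hH : ContDiff ℝ 2 H) (hH' : ∀ v, deriv H v ≤ 0) (hH0 : ∀ v, 0 ≤ H v)
    (hH2 : ∀ v, 0 ≤ deriv (deriv H) v) (hκ : ∀ v, deriv H v ^ 2 ≤ 2 * H v * deriv (deriv H) v)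
    (hHk : ∀ v, k ≤ v → H v = 0)
    {Θ : EuclideanSpace ℝ (Fin 3) → ℝ} (hΘ : ContDiff ℝ 1 Θ) (hΘc : HasCompactSupport Θ) (hΘO : tsupport Θ ⊆ O)
    {η : ℝ → ℝ} (hη : ContDiff ℝ 1 η) (hη0 : ∀ s, 0 ≤ η s)
    {t₁ t : ℝ} (h1 : lo < t₁) (h1t : t₁ ≤ t) (ht : t < hi) :
    ENNReal.ofReal (η t * ∫ x, H (Φ t x) * Θ x ^ 2) +
      ∫⁻ z in Icc t₁ t ×ˢ (univ : Set (EuclideanSpace ℝ (Fin 3))), ENNReal.ofReal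
        (1 / 2 * η z.1 * (deriv (deriv H) (Φ z.1 z.2) * ‖gradient (Φ z.1) z.2‖ ^ 2 * Θ z.2 ^ 2))
    ≤ ENNReal.ofReal (η t₁ * (∫ x, H (Φ t₁ x) * Θ x ^ 2) +
        (4 * ∫ z in Icc t₁ t ×ˢ (univ : Set (EuclideanSpace ℝ (Fin 3))),
          η z.1 * (H (Φ z.1 z.2) * ‖gradient Θ z.2‖ ^ 2)) +
        (∫ z in Icc t₁ t ×ˢ (univ : Set (EuclideanSpace ℝ (Fin 3))),
          η z.1 * (H (Φ z.1 z.2) * inner ℝ (U z.1 z.2) (gradient (fun y => Θ y ^ 2) z.2))) +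
        (∫ z in Icc t₁ t ×ˢ (univ : Set (EuclideanSpace ℝ (Fin 3))),
          η z.1 * (2 / cylRadius z.2 * (H (Φ z.1 z.2) * fderiv ℝ (fun y => Θ y ^ 2) z.2 (eR z.2)))) +
        (∫ z in Icc t₁ t ×ˢ (univ : Set (EuclideanSpace ℝ (Fin 3))), |deriv η z.1| * (H (Φ z.1 z.2) * Θ z.2 ^ 2))) := by
  have hmain := energyClass_ineq_acrossAxis hO hΦc hΦg hΦs hΦt hΦt' hUc hUs hdivU hU3 hsup hk hH hH' hH0 hH2 hκ hHk
    hΘ hΘc hΘO hη hη0 h1 h1t ht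
  -- ### integrability of the four summands on `[t₁,t] × ℝ³`
  set μ : Measure (ℝ × EuclideanSpace ℝ (Fin 3)) := (volume.restrict (Ioc t₁ t)).prod volume with hμ
  have hmeas : (volume : Measure (ℝ × EuclideanSpace ℝ (Fin 3))).restrict
      (Icc t₁ t ×ˢ (univ : Set (EuclideanSpace ℝ (Fin 3)))) = μ :=
    restrict_Icc_prod_univ_eq_restrict_Ioc_prod t₁ t
  obtain ⟨-, -, i₃, i₄, i₅⟩ := integrable_sliceIntegrands_acrossAxis hO hΦc hΦg hUc hU3 hH hΘ hΘc hΘO h1 ht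
  obtain ⟨C, hC⟩ : ∃ C, ∀ s ∈ Icc t₁ t, ‖η s‖ ≤ C ∧ ‖deriv η s‖ ≤ C := by
    obtain ⟨C₁, hC₁⟩ := isCompact_Icc.exists_bound_of_continuousOn (hη.continuous.continuousOn (s := Icc t₁ t))
    obtain ⟨C₂, hC₂⟩ := isCompact_Icc.exists_bound_of_continuousOn
      ((hη.continuous_deriv le_rfl).continuousOn (s := Icc t₁ t))
    exact ⟨max C₁ C₂, fun s hs => ⟨(hC₁ s hs).trans (le_max_left _ _), (hC₂ s hs).trans (le_max_right _ _)⟩⟩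
  have hbη : ∀ᵐ z ∂μ, ‖η z.1‖ ≤ C := by
    filter_upwards [ae_fst_mem_Ioc t₁ t] with z hz using (hC z.1 (Ioc_subset_Icc_self hz)).1
  have hbη' : ∀ᵐ z ∂μ, ‖|deriv η z.1|‖ ≤ C := by
    filter_upwards [ae_fst_mem_Ioc t₁ t] with z hz
    rw [Real.norm_eq_abs, abs_abs]
    exact (hC z.1 (Ioc_subset_Icc_self hz)).2
  have mη : AEStronglyMeasurable (fun z : ℝ × EuclideanSpace ℝ (Fin 3) => η z.1) μ :=
    (hη.continuous.comp continuous_fst).aestronglyMeasurable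
  have mη' : AEStronglyMeasurable (fun z : ℝ × EuclideanSpace ℝ (Fin 3) => |deriv η z.1|) μ :=
    (((hη.continuous_deriv le_rfl).comp continuous_fst).abs).aestronglyMeasurable
  have hK : IsCompact (tsupport Θ) := hΘc
  have hgΘ0' : ∀ x, x ∉ tsupport Θ → gradient Θ x = 0 := fun x hx => gradient_eq_zero_of_notMem_tsupport hx
  have iP : Integrable (fun z : ℝ × EuclideanSpace ℝ (Fin 3) => H (Φ z.1 z.2) * ‖gradient Θ z.2‖ ^ 2) μ :=
    integrable_prod_of_continuousOn_of_eq_zero hK hΘO h1 ht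
      ((hH.continuous.comp_continuousOn hΦc).mul
        (((continuous_gradient_of_contDiff hΘ).norm.pow 2).comp continuous_snd).continuousOn)
      (fun z hz => by simp [hgΘ0' z.2 hz])
  have jP : Integrable (fun z => η z.1 * (H (Φ z.1 z.2) * ‖gradient Θ z.2‖ ^ 2)) μ := iP.bdd_mul mη hbη
  have j₃ : Integrable (fun z => η z.1 * (H (Φ z.1 z.2) * ⟪U z.1 z.2, gradient (fun y => Θ y ^ 2) z.2⟫)) μ :=
    i₃.bdd_mul mη hbη
  have j₄ : Integrable (fun z => η z.1 *
      (2 / cylRadius z.2 * (H (Φ z.1 z.2) * fderiv ℝ (fun y => Θ y ^ 2) z.2 (eR z.2)))) μ := i₄.bdd_mul mη hbη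
  have j₅ : Integrable (fun z => |deriv η z.1| * (H (Φ z.1 z.2) * Θ z.2 ^ 2)) μ := i₅.bdd_mul mη' hbη'
  -- ### `∫Σ = Σ∫`
  have hsplit : ∫ z in Icc t₁ t ×ˢ (univ : Set (EuclideanSpace ℝ (Fin 3))),
      (4 * η z.1 * (H (Φ z.1 z.2) * ‖gradient Θ z.2‖ ^ 2) +
        η z.1 * (H (Φ z.1 z.2) * inner ℝ (U z.1 z.2) (gradient (fun y => Θ y ^ 2) z.2)) +
        η z.1 * (2 / cylRadius z.2 * (H (Φ z.1 z.2) * fderiv ℝ (fun y => Θ y ^ 2) z.2 (eR z.2))) +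
        |deriv η z.1| * (H (Φ z.1 z.2) * Θ z.2 ^ 2)) =
      (4 * ∫ z in Icc t₁ t ×ˢ (univ : Set (EuclideanSpace ℝ (Fin 3))),
          η z.1 * (H (Φ z.1 z.2) * ‖gradient Θ z.2‖ ^ 2)) +
        (∫ z in Icc t₁ t ×ˢ (univ : Set (EuclideanSpace ℝ (Fin 3))),
          η z.1 * (H (Φ z.1 z.2) * inner ℝ (U z.1 z.2) (gradient (fun y => Θ y ^ 2) z.2))) +
        (∫ z in Icc t₁ t ×ˢ (univ : Set (EuclideanSpace ℝ (Fin 3))),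
          η z.1 * (2 / cylRadius z.2 * (H (Φ z.1 z.2) * fderiv ℝ (fun y => Θ y ^ 2) z.2 (eR z.2)))) +
        (∫ z in Icc t₁ t ×ˢ (univ : Set (EuclideanSpace ℝ (Fin 3))), |deriv η z.1| * (H (Φ z.1 z.2) * Θ z.2 ^ 2)) := by
    rw [hmeas]
    have e4 : ∀ z : ℝ × EuclideanSpace ℝ (Fin 3), 4 * η z.1 * (H (Φ z.1 z.2) * ‖gradient Θ z.2‖ ^ 2) =
        4 * (η z.1 * (H (Φ z.1 z.2) * ‖gradient Θ z.2‖ ^ 2)) := fun z => by ring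
    simp_rw [e4]
    have hA : Integrable (fun z : ℝ × EuclideanSpace ℝ (Fin 3) =>
        4 * (η z.1 * (H (Φ z.1 z.2) * ‖gradient Θ z.2‖ ^ 2))) μ := jP.const_mul 4
    have hAB : Integrable (fun z : ℝ × EuclideanSpace ℝ (Fin 3) =>
        4 * (η z.1 * (H (Φ z.1 z.2) * ‖gradient Θ z.2‖ ^ 2)) +
          η z.1 * (H (Φ z.1 z.2) * ⟪U z.1 z.2, gradient (fun y => Θ y ^ 2) z.2⟫)) μ := by
      exact hA.add j₃
    have hABC : Integrable (fun z : ℝ × EuclideanSpace ℝ (Fin 3) =>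
        4 * (η z.1 * (H (Φ z.1 z.2) * ‖gradient Θ z.2‖ ^ 2)) +
          η z.1 * (H (Φ z.1 z.2) * ⟪U z.1 z.2, gradient (fun y => Θ y ^ 2) z.2⟫) +
          η z.1 * (2 / cylRadius z.2 * (H (Φ z.1 z.2) * fderiv ℝ (fun y => Θ y ^ 2) z.2 (eR z.2)))) μ := by
      exact hAB.add j₄
    rw [integral_add hABC j₅, integral_add hAB j₄, integral_add hA j₃, MeasureTheory.integral_const_mul]
  have key : η t₁ * (∫ x, H (Φ t₁ x) * Θ x ^ 2) +
        (4 * ∫ z in Icc t₁ t ×ˢ (univ : Set (EuclideanSpace ℝ (Fin 3))),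
          η z.1 * (H (Φ z.1 z.2) * ‖gradient Θ z.2‖ ^ 2)) +
        (∫ z in Icc t₁ t ×ˢ (univ : Set (EuclideanSpace ℝ (Fin 3))),
          η z.1 * (H (Φ z.1 z.2) * inner ℝ (U z.1 z.2) (gradient (fun y => Θ y ^ 2) z.2))) +
        (∫ z in Icc t₁ t ×ˢ (univ : Set (EuclideanSpace ℝ (Fin 3))),
          η z.1 * (2 / cylRadius z.2 * (H (Φ z.1 z.2) * fderiv ℝ (fun y => Θ y ^ 2) z.2 (eR z.2)))) +
        (∫ z in Icc t₁ t ×ˢ (univ : Set (EuclideanSpace ℝ (Fin 3))), |deriv η z.1| * (H (Φ z.1 z.2) * Θ z.2 ^ 2)) =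
      η t₁ * (∫ x, H (Φ t₁ x) * Θ x ^ 2) +
        ∫ z in Icc t₁ t ×ˢ (univ : Set (EuclideanSpace ℝ (Fin 3))),
          (4 * η z.1 * (H (Φ z.1 z.2) * ‖gradient Θ z.2‖ ^ 2) +
            η z.1 * (H (Φ z.1 z.2) * inner ℝ (U z.1 z.2) (gradient (fun y => Θ y ^ 2) z.2)) +
            η z.1 * (2 / cylRadius z.2 * (H (Φ z.1 z.2) * fderiv ℝ (fun y => Θ y ^ 2) z.2 (eR z.2))) +
            |deriv η z.1| * (H (Φ z.1 z.2) * Θ z.2 ^ 2)) := by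
    rw [hsplit]; ring
  rw [key]
  exact hmain


/-- **The energy-class inequality across the regular axis, REAL single-integral form** (proof of `energyClass_ineq_acrossAxis`
ending in `ℝ`): the dissipation `lintegral` is finite and `η(t)M(t) + (∬½ηH''(Φ)|∇Φ|²Θ²).toReal ≤ η(t₁)M(t₁) + ∬(4-term sum)` —
the form that telescopes over consecutive windows (F3c). [cite: NazarovUraltseva2012, §3 (3.3), (3.9), Remark 9] -/
theorem energyClass_ineq_acrossAxis_real {O : Set (EuclideanSpace ℝ (Fin 3))} (hO : IsOpen O) {lo hi : ℝ}
    {Φ : ℝ → EuclideanSpace ℝ (Fin 3) → ℝ} {U : ℝ → EuclideanSpace ℝ (Fin 3) → EuclideanSpace ℝ (Fin 3)}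
    (hΦc : ContinuousOn (uncurry Φ) (Ioo lo hi ×ˢ O))
    (hΦg : ContinuousOn (fun z : ℝ × EuclideanSpace ℝ (Fin 3) => fderiv ℝ (Φ z.1) z.2) (Ioo lo hi ×ˢ O))
    (hΦs : ∀ z ∈ Ioo lo hi ×ˢ (O ∩ {x | cylRadius x ≠ 0}), ContDiffAt ℝ 2 (Φ z.1) z.2)
    (hΦt : ∀ z ∈ Ioo lo hi ×ˢ (O ∩ {x | cylRadius x ≠ 0}), DifferentiableAt ℝ (fun r => Φ r z.2) z.1)
    (hΦt' : ContinuousOn (fun z : ℝ × EuclideanSpace ℝ (Fin 3) => deriv (fun r => Φ r z.2) z.1)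
      (Ioo lo hi ×ˢ (O ∩ {x | cylRadius x ≠ 0})))
    (hUc : ContinuousOn (uncurry U) (Ioo lo hi ×ˢ (O ∩ {x | cylRadius x ≠ 0})))
    (hUs : ∀ z ∈ Ioo lo hi ×ˢ (O ∩ {x | cylRadius x ≠ 0}), ContDiffAt ℝ 1 (U z.1) z.2)
    (hdivU : ∀ z ∈ Ioo lo hi ×ˢ (O ∩ {x | cylRadius x ≠ 0}), VectorCalculus.divergence (U z.1) z.2 = 0)
    (hU3 : (∫⁻ z in Ioo lo hi ×ˢ O, ‖U z.1 z.2‖ₑ ^ (3 : ℕ)) < ⊤)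
    (hsup : ∀ z ∈ Ioo lo hi ×ˢ (O ∩ {x | cylRadius x ≠ 0}), 0 ≤ deriv (fun r => Φ r z.2) z.1 +
      fderiv ℝ (Φ z.1) z.2 (U z.1 z.2) + 2 / cylRadius z.2 * partialDeriv (eR z.2) (Φ z.1) z.2 -
      (Laplacian.laplacian (Φ z.1)) z.2)
    {k : ℝ} (hk : ∀ z ∈ Ioo lo hi ×ˢ O, cylRadius z.2 = 0 → k ≤ Φ z.1 z.2)
    {H : ℝ → ℝ} (hH : ContDiff ℝ 2 H) (hH' : ∀ v, deriv H v ≤ 0) (hH0 : ∀ v, 0 ≤ H v)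
    (hH2 : ∀ v, 0 ≤ deriv (deriv H) v) (hκ : ∀ v, deriv H v ^ 2 ≤ 2 * H v * deriv (deriv H) v)
    (hHk : ∀ v, k ≤ v → H v = 0)
    {Θ : EuclideanSpace ℝ (Fin 3) → ℝ} (hΘ : ContDiff ℝ 1 Θ) (hΘc : HasCompactSupport Θ) (hΘO : tsupport Θ ⊆ O)
    {η : ℝ → ℝ} (hη : ContDiff ℝ 1 η) (hη0 : ∀ s, 0 ≤ η s)
    {t₁ t : ℝ} (h1 : lo < t₁) (h1t : t₁ ≤ t) (ht : t < hi) :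
    (∫⁻ z in Icc t₁ t ×ˢ (univ : Set (EuclideanSpace ℝ (Fin 3))), ENNReal.ofReal
        (1 / 2 * η z.1 * (deriv (deriv H) (Φ z.1 z.2) * ‖gradient (Φ z.1) z.2‖ ^ 2 * Θ z.2 ^ 2))) < ⊤ ∧
    η t * (∫ x, H (Φ t x) * Θ x ^ 2) +
      (∫⁻ z in Icc t₁ t ×ˢ (univ : Set (EuclideanSpace ℝ (Fin 3))), ENNReal.ofReal
        (1 / 2 * η z.1 * (deriv (deriv H) (Φ z.1 z.2) * ‖gradient (Φ z.1) z.2‖ ^ 2 * Θ z.2 ^ 2))).toReal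
    ≤ η t₁ * (∫ x, H (Φ t₁ x) * Θ x ^ 2) +
        ∫ z in Icc t₁ t ×ˢ (univ : Set (EuclideanSpace ℝ (Fin 3))),
          (4 * η z.1 * (H (Φ z.1 z.2) * ‖gradient Θ z.2‖ ^ 2) +
            η z.1 * (H (Φ z.1 z.2) * inner ℝ (U z.1 z.2) (gradient (fun y => Θ y ^ 2) z.2)) +
            η z.1 * (2 / cylRadius z.2 * (H (Φ z.1 z.2) * fderiv ℝ (fun y => Θ y ^ 2) z.2 (eR z.2))) +
            |deriv η z.1| * (H (Φ z.1 z.2) * Θ z.2 ^ 2)) := by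
  set μ : Measure (ℝ × EuclideanSpace ℝ (Fin 3)) := (volume.restrict (Ioc t₁ t)).prod volume with hμ
  set g₁ : ℝ × EuclideanSpace ℝ (Fin 3) → ℝ := fun z =>
    deriv (deriv H) (Φ z.1 z.2) * ‖gradient (Φ z.1) z.2‖ ^ 2 * Θ z.2 ^ 2 with hg₁
  set g₂ : ℝ × EuclideanSpace ℝ (Fin 3) → ℝ := fun z =>
    deriv H (Φ z.1 z.2) * ⟪gradient (Φ z.1) z.2, gradient (fun y => Θ y ^ 2) z.2⟫ with hg₂
  set g₃ : ℝ × EuclideanSpace ℝ (Fin 3) → ℝ := fun z =>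
    H (Φ z.1 z.2) * ⟪U z.1 z.2, gradient (fun y => Θ y ^ 2) z.2⟫ with hg₃
  set g₄ : ℝ × EuclideanSpace ℝ (Fin 3) → ℝ := fun z =>
    2 / cylRadius z.2 * (H (Φ z.1 z.2) * fderiv ℝ (fun y => Θ y ^ 2) z.2 (eR z.2)) with hg₄
  set g₅ : ℝ × EuclideanSpace ℝ (Fin 3) → ℝ := fun z => H (Φ z.1 z.2) * Θ z.2 ^ 2 with hg₅
  set gP : ℝ × EuclideanSpace ℝ (Fin 3) → ℝ := fun z => H (Φ z.1 z.2) * ‖gradient Θ z.2‖ ^ 2 with hgP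
  set F : ℝ × EuclideanSpace ℝ (Fin 3) → ℝ := fun z =>
    η z.1 * (-(g₁ z + g₂ z) + g₃ z + g₄ z) + deriv η z.1 * g₅ z with hFdef
  set Rf : ℝ × EuclideanSpace ℝ (Fin 3) → ℝ := fun z =>
    4 * η z.1 * gP z + η z.1 * g₃ z + η z.1 * g₄ z + |deriv η z.1| * g₅ z with hRfdef
  obtain ⟨i₁, i₂, i₃, i₄, i₅⟩ := integrable_sliceIntegrands_acrossAxis hO hΦc hΦg hUc hU3 hH hΘ hΘc hΘO h1 ht
  have hFub := intervalIntegral_sliceFunctionals_eq_integral_prod hη h1t i₁ i₂ i₃ i₄ i₅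
  have iF : Integrable F μ := hFub.1
  have hmain := supersolution_energy_ineq_acrossAxis O hO lo hi Φ U hΦc hΦg hΦs hΦt hΦt' hUc hUs hdivU hU3 hsup k hk
    H hH hH' hHk Θ hΘ hΘc hΘO η hη hη0 t₁ t h1 h1t ht
    (fun s => ∫ x, H (Φ s x) * Θ x ^ 2)
    (fun s => ∫ x, deriv (deriv H) (Φ s x) * ‖gradient (Φ s) x‖ ^ 2 * Θ x ^ 2)
    (fun s => ∫ x, deriv H (Φ s x) * ⟪gradient (Φ s) x, gradient (fun y => Θ y ^ 2) x⟫)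
    (fun s => ∫ x, H (Φ s x) * ⟪U s x, gradient (fun y => Θ y ^ 2) x⟫)
    (fun s => ∫ x, 2 / cylRadius x * (H (Φ s x) * fderiv ℝ (fun y => Θ y ^ 2) x (eR x)))
    (fun _ => rfl) (fun _ => rfl) (fun _ => rfl) (fun _ => rfl) (fun _ => rfl)
  have hmain' : η t * (∫ x, H (Φ t x) * Θ x ^ 2) - η t₁ * (∫ x, H (Φ t₁ x) * Θ x ^ 2) ≤ ∫ z, F z ∂μ := by
    rw [← hFub.2]; exact hmain
  obtain ⟨C, hC⟩ : ∃ C, ∀ s ∈ Icc t₁ t, ‖η s‖ ≤ C ∧ ‖deriv η s‖ ≤ C := by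
    obtain ⟨C₁, hC₁⟩ := isCompact_Icc.exists_bound_of_continuousOn (hη.continuous.continuousOn (s := Icc t₁ t))
    obtain ⟨C₂, hC₂⟩ := isCompact_Icc.exists_bound_of_continuousOn
      ((hη.continuous_deriv le_rfl).continuousOn (s := Icc t₁ t))
    exact ⟨max C₁ C₂, fun s hs => ⟨(hC₁ s hs).trans (le_max_left _ _), (hC₂ s hs).trans (le_max_right _ _)⟩⟩
  have hbη : ∀ᵐ z ∂μ, ‖η z.1‖ ≤ C := by
    filter_upwards [ae_fst_mem_Ioc t₁ t] with z hz using (hC z.1 (Ioc_subset_Icc_self hz)).1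
  have hbη' : ∀ᵐ z ∂μ, ‖|deriv η z.1|‖ ≤ C := by
    filter_upwards [ae_fst_mem_Ioc t₁ t] with z hz
    rw [Real.norm_eq_abs, abs_abs]
    exact (hC z.1 (Ioc_subset_Icc_self hz)).2
  have mη : AEStronglyMeasurable (fun z : ℝ × EuclideanSpace ℝ (Fin 3) => η z.1) μ :=
    (hη.continuous.comp continuous_fst).aestronglyMeasurable
  have mη' : AEStronglyMeasurable (fun z : ℝ × EuclideanSpace ℝ (Fin 3) => |deriv η z.1|) μ :=
    (((hη.continuous_deriv le_rfl).comp continuous_fst).abs).aestronglyMeasurable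
  have hK : IsCompact (tsupport Θ) := hΘc
  have hgΘ0' : ∀ x, x ∉ tsupport Θ → gradient Θ x = 0 := fun x hx => gradient_eq_zero_of_notMem_tsupport hx
  have iP : Integrable gP μ :=
    integrable_prod_of_continuousOn_of_eq_zero hK hΘO h1 ht
      ((hH.continuous.comp_continuousOn hΦc).mul
        (((continuous_gradient_of_contDiff hΘ).norm.pow 2).comp continuous_snd).continuousOn)
      (fun z hz => by simp [hgP, hgΘ0' z.2 hz])
  have iη₁ : Integrable (fun z => η z.1 * g₁ z) μ := i₁.bdd_mul mη hbη
  have iR : Integrable Rf μ :=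
    ((((iP.bdd_mul mη hbη).const_mul 4).add (i₃.bdd_mul mη hbη)).add (i₄.bdd_mul mη hbη)).add
      (i₅.bdd_mul mη' hbη') |>.congr (ae_of_all _ fun z => by simp only [hRfdef, Pi.add_apply]; ring)
  have hpt : ∀ z, F z ≤ -(1 / 2) * (η z.1 * g₁ z) + Rf z := by
    intro z
    have hcross := neg_cross_le_pointwise hH0 hH2 hκ hΘ (Φ z.1) z.2
    have h1 : η z.1 * (-(g₂ z)) ≤ η z.1 * (g₁ z / 2 + 4 * gP z) := by
      refine mul_le_mul_of_nonneg_left ?_ (hη0 _)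
      simpa only [hg₁, hg₂, hgP] using hcross
    have h5 : 0 ≤ g₅ z := mul_nonneg (hH0 _) (sq_nonneg _)
    have h2 : deriv η z.1 * g₅ z ≤ |deriv η z.1| * g₅ z := mul_le_mul_of_nonneg_right (le_abs_self _) h5
    simp only [hFdef, hRfdef]
    nlinarith [h1, h2]
  have hint_le : ∫ z, F z ∂μ ≤ -(1 / 2) * (∫ z, η z.1 * g₁ z ∂μ) + ∫ z, Rf z ∂μ := by
    have iS : Integrable (fun z => -(1 / 2) * (η z.1 * g₁ z) + Rf z) μ := by exact (iη₁.const_mul _).add iR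
    refine (integral_mono (g := fun z => -(1 / 2) * (η z.1 * g₁ z) + Rf z) iF iS hpt).trans_eq ?_
    rw [integral_add (iη₁.const_mul _) iR, MeasureTheory.integral_const_mul]
  have hD0 : ∀ z, 0 ≤ η z.1 * g₁ z := fun z =>
    mul_nonneg (hη0 _) (mul_nonneg (mul_nonneg (hH2 _) (sq_nonneg _)) (sq_nonneg _))
  have hDint0 : 0 ≤ ∫ z, η z.1 * g₁ z ∂μ := integral_nonneg hD0
  have hmeas : (volume : Measure (ℝ × EuclideanSpace ℝ (Fin 3))).restrict
      (Icc t₁ t ×ˢ (univ : Set (EuclideanSpace ℝ (Fin 3)))) = μ :=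
    restrict_Icc_prod_univ_eq_restrict_Ioc_prod t₁ t
  have hdiss : ∫⁻ z in Icc t₁ t ×ˢ (univ : Set (EuclideanSpace ℝ (Fin 3))), ENNReal.ofReal
        (1 / 2 * η z.1 * (deriv (deriv H) (Φ z.1 z.2) * ‖gradient (Φ z.1) z.2‖ ^ 2 * Θ z.2 ^ 2)) =
      ENNReal.ofReal (1 / 2 * ∫ z, η z.1 * g₁ z ∂μ) := by
    rw [hmeas, ← MeasureTheory.integral_const_mul,
      ofReal_integral_eq_lintegral_ofReal (iη₁.const_mul _)
        (ae_of_all _ fun z => mul_nonneg (by norm_num) (hD0 z))]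
    refine lintegral_congr fun z => ?_
    simp only [hg₁]
    ring_nf
  have hRHS : ∫ z in Icc t₁ t ×ˢ (univ : Set (EuclideanSpace ℝ (Fin 3))),
      (4 * η z.1 * (H (Φ z.1 z.2) * ‖gradient Θ z.2‖ ^ 2) +
        η z.1 * (H (Φ z.1 z.2) * inner ℝ (U z.1 z.2) (gradient (fun y => Θ y ^ 2) z.2)) +
        η z.1 * (2 / cylRadius z.2 * (H (Φ z.1 z.2) * fderiv ℝ (fun y => Θ y ^ 2) z.2 (eR z.2))) +
        |deriv η z.1| * (H (Φ z.1 z.2) * Θ z.2 ^ 2)) = ∫ z, Rf z ∂μ := by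
    rw [hmeas]
  rw [hdiss, hRHS, ENNReal.toReal_ofReal (by positivity)]
  exact ⟨ENNReal.ofReal_lt_top, by linarith [hmain', hint_le]⟩

/-- **The energy-class inequality across the regular axis, REAL v3 SPLIT form** (F3c's telescoping input): dissipation finite and
`η(t)M(t) + (∬…).toReal ≤ η(t₁)M(t₁) + 4∬… + ∬… + ∬… + ∬…` (canonical v3 split). [cite: NazarovUraltseva2012, §3 (3.3), (3.9), Remark 9] -/
theorem energyClass_ineq_acrossAxis_v3_real {O : Set (EuclideanSpace ℝ (Fin 3))} (hO : IsOpen O) {lo hi : ℝ}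
    {Φ : ℝ → EuclideanSpace ℝ (Fin 3) → ℝ} {U : ℝ → EuclideanSpace ℝ (Fin 3) → EuclideanSpace ℝ (Fin 3)}
    (hΦc : ContinuousOn (uncurry Φ) (Ioo lo hi ×ˢ O))
    (hΦg : ContinuousOn (fun z : ℝ × EuclideanSpace ℝ (Fin 3) => fderiv ℝ (Φ z.1) z.2) (Ioo lo hi ×ˢ O))
    (hΦs : ∀ z ∈ Ioo lo hi ×ˢ (O ∩ {x | cylRadius x ≠ 0}), ContDiffAt ℝ 2 (Φ z.1) z.2)
    (hΦt : ∀ z ∈ Ioo lo hi ×ˢ (O ∩ {x | cylRadius x ≠ 0}), DifferentiableAt ℝ (fun r => Φ r z.2) z.1)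
    (hΦt' : ContinuousOn (fun z : ℝ × EuclideanSpace ℝ (Fin 3) => deriv (fun r => Φ r z.2) z.1)
      (Ioo lo hi ×ˢ (O ∩ {x | cylRadius x ≠ 0})))
    (hUc : ContinuousOn (uncurry U) (Ioo lo hi ×ˢ (O ∩ {x | cylRadius x ≠ 0})))
    (hUs : ∀ z ∈ Ioo lo hi ×ˢ (O ∩ {x | cylRadius x ≠ 0}), ContDiffAt ℝ 1 (U z.1) z.2)
    (hdivU : ∀ z ∈ Ioo lo hi ×ˢ (O ∩ {x | cylRadius x ≠ 0}), VectorCalculus.divergence (U z.1) z.2 = 0)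
    (hU3 : (∫⁻ z in Ioo lo hi ×ˢ O, ‖U z.1 z.2‖ₑ ^ (3 : ℕ)) < ⊤)
    (hsup : ∀ z ∈ Ioo lo hi ×ˢ (O ∩ {x | cylRadius x ≠ 0}), 0 ≤ deriv (fun r => Φ r z.2) z.1 +
      fderiv ℝ (Φ z.1) z.2 (U z.1 z.2) + 2 / cylRadius z.2 * partialDeriv (eR z.2) (Φ z.1) z.2 -
      (Laplacian.laplacian (Φ z.1)) z.2)
    {k : ℝ} (hk : ∀ z ∈ Ioo lo hi ×ˢ O, cylRadius z.2 = 0 → k ≤ Φ z.1 z.2)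
    {H : ℝ → ℝ} (hH : ContDiff ℝ 2 H) (hH' : ∀ v, deriv H v ≤ 0) (hH0 : ∀ v, 0 ≤ H v)
    (hH2 : ∀ v, 0 ≤ deriv (deriv H) v) (hκ : ∀ v, deriv H v ^ 2 ≤ 2 * H v * deriv (deriv H) v)
    (hHk : ∀ v, k ≤ v → H v = 0)
    {Θ : EuclideanSpace ℝ (Fin 3) → ℝ} (hΘ : ContDiff ℝ 1 Θ) (hΘc : HasCompactSupport Θ) (hΘO : tsupport Θ ⊆ O)
    {η : ℝ → ℝ} (hη : ContDiff ℝ 1 η) (hη0 : ∀ s, 0 ≤ η s)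
    {t₁ t : ℝ} (h1 : lo < t₁) (h1t : t₁ ≤ t) (ht : t < hi) :
    (∫⁻ z in Icc t₁ t ×ˢ (univ : Set (EuclideanSpace ℝ (Fin 3))), ENNReal.ofReal
        (1 / 2 * η z.1 * (deriv (deriv H) (Φ z.1 z.2) * ‖gradient (Φ z.1) z.2‖ ^ 2 * Θ z.2 ^ 2))) < ⊤ ∧
    η t * (∫ x, H (Φ t x) * Θ x ^ 2) +
      (∫⁻ z in Icc t₁ t ×ˢ (univ : Set (EuclideanSpace ℝ (Fin 3))), ENNReal.ofReal
        (1 / 2 * η z.1 * (deriv (deriv H) (Φ z.1 z.2) * ‖gradient (Φ z.1) z.2‖ ^ 2 * Θ z.2 ^ 2))).toReal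
    ≤ η t₁ * (∫ x, H (Φ t₁ x) * Θ x ^ 2) +
        (4 * ∫ z in Icc t₁ t ×ˢ (univ : Set (EuclideanSpace ℝ (Fin 3))),
          η z.1 * (H (Φ z.1 z.2) * ‖gradient Θ z.2‖ ^ 2)) +
        (∫ z in Icc t₁ t ×ˢ (univ : Set (EuclideanSpace ℝ (Fin 3))),
          η z.1 * (H (Φ z.1 z.2) * inner ℝ (U z.1 z.2) (gradient (fun y => Θ y ^ 2) z.2))) +
        (∫ z in Icc t₁ t ×ˢ (univ : Set (EuclideanSpace ℝ (Fin 3))),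
          η z.1 * (2 / cylRadius z.2 * (H (Φ z.1 z.2) * fderiv ℝ (fun y => Θ y ^ 2) z.2 (eR z.2)))) +
        (∫ z in Icc t₁ t ×ˢ (univ : Set (EuclideanSpace ℝ (Fin 3))), |deriv η z.1| * (H (Φ z.1 z.2) * Θ z.2 ^ 2)) := by
  have hmain := energyClass_ineq_acrossAxis_real hO hΦc hΦg hΦs hΦt hΦt' hUc hUs hdivU hU3 hsup hk hH hH' hH0 hH2 hκ hHk
    hΘ hΘc hΘO hη hη0 h1 h1t ht
  refine ⟨hmain.1, ?_⟩
  set μ : Measure (ℝ × EuclideanSpace ℝ (Fin 3)) := (volume.restrict (Ioc t₁ t)).prod volume with hμ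
  have hmeas : (volume : Measure (ℝ × EuclideanSpace ℝ (Fin 3))).restrict
      (Icc t₁ t ×ˢ (univ : Set (EuclideanSpace ℝ (Fin 3)))) = μ :=
    restrict_Icc_prod_univ_eq_restrict_Ioc_prod t₁ t
  obtain ⟨-, -, i₃, i₄, i₅⟩ := integrable_sliceIntegrands_acrossAxis hO hΦc hΦg hUc hU3 hH hΘ hΘc hΘO h1 ht
  obtain ⟨C, hC⟩ : ∃ C, ∀ s ∈ Icc t₁ t, ‖η s‖ ≤ C ∧ ‖deriv η s‖ ≤ C := by
    obtain ⟨C₁, hC₁⟩ := isCompact_Icc.exists_bound_of_continuousOn (hη.continuous.continuousOn (s := Icc t₁ t))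
    obtain ⟨C₂, hC₂⟩ := isCompact_Icc.exists_bound_of_continuousOn
      ((hη.continuous_deriv le_rfl).continuousOn (s := Icc t₁ t))
    exact ⟨max C₁ C₂, fun s hs => ⟨(hC₁ s hs).trans (le_max_left _ _), (hC₂ s hs).trans (le_max_right _ _)⟩⟩
  have hbη : ∀ᵐ z ∂μ, ‖η z.1‖ ≤ C := by
    filter_upwards [ae_fst_mem_Ioc t₁ t] with z hz using (hC z.1 (Ioc_subset_Icc_self hz)).1
  have hbη' : ∀ᵐ z ∂μ, ‖|deriv η z.1|‖ ≤ C := by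
    filter_upwards [ae_fst_mem_Ioc t₁ t] with z hz
    rw [Real.norm_eq_abs, abs_abs]
    exact (hC z.1 (Ioc_subset_Icc_self hz)).2
  have mη : AEStronglyMeasurable (fun z : ℝ × EuclideanSpace ℝ (Fin 3) => η z.1) μ :=
    (hη.continuous.comp continuous_fst).aestronglyMeasurable
  have mη' : AEStronglyMeasurable (fun z : ℝ × EuclideanSpace ℝ (Fin 3) => |deriv η z.1|) μ :=
    (((hη.continuous_deriv le_rfl).comp continuous_fst).abs).aestronglyMeasurable
  have hK : IsCompact (tsupport Θ) := hΘc
  have hgΘ0' : ∀ x, x ∉ tsupport Θ → gradient Θ x = 0 := fun x hx => gradient_eq_zero_of_notMem_tsupport hx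
  have iP : Integrable (fun z : ℝ × EuclideanSpace ℝ (Fin 3) => H (Φ z.1 z.2) * ‖gradient Θ z.2‖ ^ 2) μ :=
    integrable_prod_of_continuousOn_of_eq_zero hK hΘO h1 ht
      ((hH.continuous.comp_continuousOn hΦc).mul
        (((continuous_gradient_of_contDiff hΘ).norm.pow 2).comp continuous_snd).continuousOn)
      (fun z hz => by simp [hgΘ0' z.2 hz])
  have jP : Integrable (fun z => η z.1 * (H (Φ z.1 z.2) * ‖gradient Θ z.2‖ ^ 2)) μ := iP.bdd_mul mη hbη
  have j₃ : Integrable (fun z => η z.1 * (H (Φ z.1 z.2) * ⟪U z.1 z.2, gradient (fun y => Θ y ^ 2) z.2⟫)) μ :=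
    i₃.bdd_mul mη hbη
  have j₄ : Integrable (fun z => η z.1 *
      (2 / cylRadius z.2 * (H (Φ z.1 z.2) * fderiv ℝ (fun y => Θ y ^ 2) z.2 (eR z.2)))) μ := i₄.bdd_mul mη hbη
  have j₅ : Integrable (fun z => |deriv η z.1| * (H (Φ z.1 z.2) * Θ z.2 ^ 2)) μ := i₅.bdd_mul mη' hbη'
  have hsplit : ∫ z in Icc t₁ t ×ˢ (univ : Set (EuclideanSpace ℝ (Fin 3))),
      (4 * η z.1 * (H (Φ z.1 z.2) * ‖gradient Θ z.2‖ ^ 2) +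
        η z.1 * (H (Φ z.1 z.2) * inner ℝ (U z.1 z.2) (gradient (fun y => Θ y ^ 2) z.2)) +
        η z.1 * (2 / cylRadius z.2 * (H (Φ z.1 z.2) * fderiv ℝ (fun y => Θ y ^ 2) z.2 (eR z.2))) +
        |deriv η z.1| * (H (Φ z.1 z.2) * Θ z.2 ^ 2)) =
      (4 * ∫ z in Icc t₁ t ×ˢ (univ : Set (EuclideanSpace ℝ (Fin 3))),
          η z.1 * (H (Φ z.1 z.2) * ‖gradient Θ z.2‖ ^ 2)) +
        (∫ z in Icc t₁ t ×ˢ (univ : Set (EuclideanSpace ℝ (Fin 3))),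
          η z.1 * (H (Φ z.1 z.2) * inner ℝ (U z.1 z.2) (gradient (fun y => Θ y ^ 2) z.2))) +
        (∫ z in Icc t₁ t ×ˢ (univ : Set (EuclideanSpace ℝ (Fin 3))),
          η z.1 * (2 / cylRadius z.2 * (H (Φ z.1 z.2) * fderiv ℝ (fun y => Θ y ^ 2) z.2 (eR z.2)))) +
        (∫ z in Icc t₁ t ×ˢ (univ : Set (EuclideanSpace ℝ (Fin 3))), |deriv η z.1| * (H (Φ z.1 z.2) * Θ z.2 ^ 2)) := by
    rw [hmeas]
    have e4 : ∀ z : ℝ × EuclideanSpace ℝ (Fin 3), 4 * η z.1 * (H (Φ z.1 z.2) * ‖gradient Θ z.2‖ ^ 2) =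
        4 * (η z.1 * (H (Φ z.1 z.2) * ‖gradient Θ z.2‖ ^ 2)) := fun z => by ring
    simp_rw [e4]
    have hA : Integrable (fun z : ℝ × EuclideanSpace ℝ (Fin 3) =>
        4 * (η z.1 * (H (Φ z.1 z.2) * ‖gradient Θ z.2‖ ^ 2))) μ := jP.const_mul 4
    have hAB : Integrable (fun z : ℝ × EuclideanSpace ℝ (Fin 3) =>
        4 * (η z.1 * (H (Φ z.1 z.2) * ‖gradient Θ z.2‖ ^ 2)) +
          η z.1 * (H (Φ z.1 z.2) * ⟪U z.1 z.2, gradient (fun y => Θ y ^ 2) z.2⟫)) μ := by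
      exact hA.add j₃
    have hABC : Integrable (fun z : ℝ × EuclideanSpace ℝ (Fin 3) =>
        4 * (η z.1 * (H (Φ z.1 z.2) * ‖gradient Θ z.2‖ ^ 2)) +
          η z.1 * (H (Φ z.1 z.2) * ⟪U z.1 z.2, gradient (fun y => Θ y ^ 2) z.2⟫) +
          η z.1 * (2 / cylRadius z.2 * (H (Φ z.1 z.2) * fderiv ℝ (fun y => Θ y ^ 2) z.2 (eR z.2)))) μ := by
      exact hAB.add j₄
    rw [integral_add hABC j₅, integral_add hAB j₄, integral_add hA j₃, MeasureTheory.integral_const_mul]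
  have key : η t₁ * (∫ x, H (Φ t₁ x) * Θ x ^ 2) +
        (4 * ∫ z in Icc t₁ t ×ˢ (univ : Set (EuclideanSpace ℝ (Fin 3))),
          η z.1 * (H (Φ z.1 z.2) * ‖gradient Θ z.2‖ ^ 2)) +
        (∫ z in Icc t₁ t ×ˢ (univ : Set (EuclideanSpace ℝ (Fin 3))),
          η z.1 * (H (Φ z.1 z.2) * inner ℝ (U z.1 z.2) (gradient (fun y => Θ y ^ 2) z.2))) +
        (∫ z in Icc t₁ t ×ˢ (univ : Set (EuclideanSpace ℝ (Fin 3))),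
          η z.1 * (2 / cylRadius z.2 * (H (Φ z.1 z.2) * fderiv ℝ (fun y => Θ y ^ 2) z.2 (eR z.2)))) +
        (∫ z in Icc t₁ t ×ˢ (univ : Set (EuclideanSpace ℝ (Fin 3))), |deriv η z.1| * (H (Φ z.1 z.2) * Θ z.2 ^ 2)) =
      η t₁ * (∫ x, H (Φ t₁ x) * Θ x ^ 2) +
        ∫ z in Icc t₁ t ×ˢ (univ : Set (EuclideanSpace ℝ (Fin 3))),
          (4 * η z.1 * (H (Φ z.1 z.2) * ‖gradient Θ z.2‖ ^ 2) +
            η z.1 * (H (Φ z.1 z.2) * inner ℝ (U z.1 z.2) (gradient (fun y => Θ y ^ 2) z.2)) +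
            η z.1 * (2 / cylRadius z.2 * (H (Φ z.1 z.2) * fderiv ℝ (fun y => Θ y ^ 2) z.2 (eR z.2))) +
            |deriv η z.1| * (H (Φ z.1 z.2) * Θ z.2 ^ 2)) := by
    rw [hsplit]; ring
  rw [key]
  exact hmain.2

end Summit.NavierStokesRegularity.NavierStokesRegularity.Theorems.AxisymmetricKatoGlobal.EulerScaling

end
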